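import Summits.ABC.StewartYu.ArchG3PackLinesV
import Summits.ABC.StewartYu.ArchG3PackLinesVH
import Summits.ABC.StewartYu.ArchG3PacksV
import HarnessLib

/-!
# Cell abc-stewartyu, rung A1.L (crux r2 `ArchCoreRat`, stmt-ABC-20502), WP-L.A: the LETTER-LINES PACKAGE `ArchLinesHoldV` of the
# one-stage archimedean frame at `S(θ)` and the proof `ArchLinesHoldV ⇒ ArchPacksHoldV` (the content of `stub_packsArch`, v4 cut R42/R43)

`Summits/ABC/StewartYu/ArchG3LinesV.lean` — cell `abc-stewartyu` (HOME `run/shared/lean/pub/abc-stewartyu/`; plan RULINGS R38 (3), R42, R43: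
«`stub_recLinesArch` (record, seat p1) = the letter lines; `stub_packsArch` (seat p5) = letter lines ⇒ `ArchPacksHoldV`»; seat p5 g9).
Four plain `Prop`-valued definitions and one theorem on `ArchG3Setup`; no named fact, no numerics, no record.

* `KStepLinesV`, `OddStepLinesV`, `HalfStepLinesV` — for ONE step of the schedule (symmetric k-step, odd-node first k-step of a level,
  Kummer half-step), the conjunction «step side conditions ∧ box ceilings ∧ the three log-linear lines (J)/(F)/(C)»; the texts of the
  lines are VERBATIM the hypotheses `hJ`/`hFl`/`hCl` of `archKStepHypD_of_logLinesV` / `archKStepOddHypD_of_logLinesV`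
  (`ArchG3PackLinesV`) / `archHalfStepHypD_of_logLinesV` (`ArchG3PackLinesVH`).
* **`ArchLinesHoldV F H Ŝ s U P δ₀ wl γb cl el Bv N T Nh`** — same explicit arguments, in the same order, as `ArchPacksHoldV`
  (`ArchG3PacksV`): there exist letters `L₀` (degree ceiling of `U`), `t : ℕ → ℕ → ℕ` (order drops), `A, V : Fin n → ℝ` (sizes of
  `log θ` and heights of the original generators), `E, C, cb : ℕ → ℕ → ℝ` (Schwarz radius, Cauchy radius, box ceilings per step
  `(lev, ν)`), `cbo, cbh : ℕ → ℝ` (odd-node and half-point box ceilings), `cU, cP, cH : ℝ` (ceilings of `log #U`, `log P`,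
  `log ∏ H(θⱼ)`), such that the global side conditions hold and, LEVEL-WISE EXACTLY AS IN `ArchPacksHoldV`, the step packages:
  level `0`: `KStepLinesV` at `(0, ν)`, `ν < n`; for every `lev < Ŝ`: `HalfStepLinesV` at `(lev, n) → (lev+1, 0)` (with
  `ex := Ŝ − (lev+1)`, so `R = Δ ∘ 2^{ex+1}·`, `R′ = Δ ∘ 2^{ex}·`), `OddStepLinesV` at `(lev+1, 0)` (`m := Nh (lev+1)`), and
  `KStepLinesV` at `(lev+1, ν)`, `1 ≤ ν < n`.
* **`archPacksHoldV_of_linesHoldV : ArchLinesHoldV … → ArchPacksHoldV …`** — the level-wise assembly (the three constructors of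
  `ArchG3PackLinesV`/`…VH`; for the half-step `Ŝ − lev = (Ŝ − (lev+1)) + 1`).  This is the proposed TEXT and PROOF of
  `Sig.stub_packsArch` of line `arch-g3-frame`; `Sig.stub_recLinesArch` (seat p1) is `ArchLinesHoldV` at the START's letters.

WHAT THIS IS NOT: the lines themselves (record arithmetic `ArchG3RecA/B`, seat p1); the START; no crux moves by itself.

## References
* Yu. V. Nesterenko, LNM 1819 (2003) — §4 Prop. 4.1 (the induction over `(s, ν)`), §4.2 (4.24)–(4.35) p. 87–90 (k-step budget),
  §4.3 (4.36)–(4.51) p. 90–95 (half-step budget). [Nesterenko2003]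
* K. Yu, Acta Math. 211 (2013) — Lemma 5.2 (the `p`-adic model of the lines layer). [Yu2013]
-/

noncomputable section

open Finset Polynomial
open scoped Matrix
open Literature.NumberTheory.Transcendental
open Literature.NumberTheory.Transcendental.CW77 (heightProd)
open Summit.ABC.StewartYu.ArchSupply (scaledFeldR WC)
open scoped Nat

namespace Summit.ABC.StewartYu

namespace ArchG3Setup

variable (S : ArchG3Setup)

/-! ### One step's lines -/

/-- **The symmetric k-step's letter package at one step** (`R = Δ(·; ℓ, H) ∘ 2^{ex}·`, box `L`, slab `(w, γb)`, Δ-basis `(c, e)`,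
virtual box `Bv`, nodes `N → N′`, orders `T → T′` with drop `t`, sizes `A`, radii `E, C`, heights `V`, ceilings `cU, cP, cb, cb′`):
`1 ≤ t`, `T′ + t ≤ T`, `N′ ≤ 3N + 2`, `1 ≤ E`, `L_{j₀}·δ₀·(3N+2) ≤ 1`, `1 ≤ C`, `2L_{j₀}δ₀N ≤ e^{cb}`, `2L_{j₀}δ₀N′ ≤ e^{cb′}`, and the
lines (J)/(F)/(C) — verbatim the hypotheses `hJ`/`hFl`/`hCl` of `archKStepHypD_of_logLinesV`.
[cite: Nesterenko2003, §4.2 (4.24)–(4.35), p. 87–90; shape only] -/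
def KStepLinesV (F : S.SatData) (H ex L₀ : ℕ) (L : Fin S.n → ℕ) (w γb : ℝ) (c : ℤ) (e : Fin S.n → ℤ) (δ₀ : ℝ)
    (Bv : Fin S.n → ℕ) (N N' T T' t : ℕ) (A : Fin S.n → ℝ) (E C : ℝ) (V : Fin S.n → ℝ) (cU cP cb cb' : ℝ) : Prop :=
  1 ≤ t ∧ T' + t ≤ T ∧ N' ≤ 3 * N + 2 ∧ 1 ≤ E ∧ (L S.j₀ : ℝ) * δ₀ * (3 * N + 2) ≤ 1 ∧ 1 ≤ C ∧
  2 * ((L S.j₀ : ℝ) * δ₀ * N) ≤ Real.exp cb ∧ 2 * ((L S.j₀ : ℝ) * δ₀ * N') ≤ Real.exp cb' ∧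
  (∀ (x₁ : ℤ) (a : ℕ), |x₁| ≤ (N' : ℤ) → a < T' →
    γb * N' + Real.log (2 * ((2 * N + 1 : ℕ) : ℝ) ^ (t + 1) * t * (20 * Real.exp 1) ^ ((2 * N + 1) * t)) +
      t * Real.log (2 * C) + γb * (N + 1) + a * Real.log 2 + (∑ k, A k * S.GammaC L k) / C + cU + cP +
      Real.log (DΔC (S.YC c e L) T') + Real.log (WC H ex L₀ T (3 * N + 2)) + (γb + w) * N + cb +
      (23 / 20 * a * H + 2 * |(x₁ : ℝ)| * (∑ j, ((Bv j : ℝ) / F.N) * V j) + 2 * ∑ j, V j) + Real.log 3 ≤ 0) ∧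
  (∀ (x₁ : ℤ) (a : ℕ), |x₁| ≤ (N' : ℤ) → a < T' →
    γb * N' + cU + cP + Real.log (DΔC (S.YC c e L) T') + Real.log (WC H ex L₀ T' ((3 * E + 1) * (2 * N + 1) + N)) +
      (w + (L S.j₀ : ℝ) * δ₀) * ((3 * E + 1) * (2 * N + 1) + N) - ((2 * N + 1) * t : ℕ) * Real.log E +
      (23 / 20 * a * H + 2 * |(x₁ : ℝ)| * (∑ j, ((Bv j : ℝ) / F.N) * V j) + 2 * ∑ j, V j) + Real.log 3 ≤ 0) ∧
  (∀ (x₁ : ℤ) (a : ℕ), |x₁| ≤ (N' : ℤ) → a < T' →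
    cU + cP + Real.log (DΔC (S.YC c e L) T') + Real.log (WC H ex L₀ T (3 * N + 2)) + (γb + w) * N' + cb' +
      (23 / 20 * a * H + 2 * |(x₁ : ℝ)| * (∑ j, ((Bv j : ℝ) / F.N) * V j) + 2 * ∑ j, V j) + Real.log 3 < 0)

/-- **The odd-node k-step's letter package** (first step of a level `≥ 1`; nodes `𝒳_{s,0} = {odd x, |x| ≤ 2m − 1}`, `N′ ≤ 6m`):
`1 ≤ m`, `1 ≤ t`, `T′ + t ≤ T`, `N′ ≤ 6m`, `1 ≤ E`, `L_{j₀}·δ₀·6m ≤ 1`, `1 ≤ C`, `2L_{j₀}δ₀(2m−1) ≤ e^{cb}`, `2L_{j₀}δ₀N′ ≤ e^{cb′}`, and the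
lines (J)/(F)/(C) — verbatim the hypotheses of `archKStepOddHypD_of_logLinesV`. [cite: Nesterenko2003, §4.2 with the nodes 𝒳_{s,0},
p. 87–90; shape only] -/
def OddStepLinesV (F : S.SatData) (H ex L₀ : ℕ) (L : Fin S.n → ℕ) (w γb : ℝ) (c : ℤ) (e : Fin S.n → ℤ) (δ₀ : ℝ)
    (Bv : Fin S.n → ℕ) (m N' T T' t : ℕ) (A : Fin S.n → ℝ) (E C : ℝ) (V : Fin S.n → ℝ) (cU cP cb cb' : ℝ) : Prop :=
  1 ≤ m ∧ 1 ≤ t ∧ T' + t ≤ T ∧ N' ≤ 6 * m ∧ 1 ≤ E ∧ (L S.j₀ : ℝ) * δ₀ * (6 * m) ≤ 1 ∧ 1 ≤ C ∧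
  2 * ((L S.j₀ : ℝ) * δ₀ * ((2 * m - 1 : ℕ) : ℝ)) ≤ Real.exp cb ∧ 2 * ((L S.j₀ : ℝ) * δ₀ * N') ≤ Real.exp cb' ∧
  (∀ (x₁ : ℤ) (a : ℕ), |x₁| ≤ (N' : ℤ) → a < T' →
    γb * N' + Real.log (2 * ((2 * m : ℕ) : ℝ) ^ (t + 1) * t * (20 * Real.exp 1) ^ ((2 * m) * t)) + t * Real.log 2 +
      t * Real.log (2 * C) + γb * (2 * m) + a * Real.log 2 + (∑ k, A k * S.GammaC L k) / C + cU + cP +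
      Real.log (DΔC (S.YC c e L) T') + Real.log (WC H ex L₀ T (6 * m)) + (γb + w) * ((2 * m - 1 : ℕ) : ℝ) + cb +
      (23 / 20 * a * H + 2 * |(x₁ : ℝ)| * (∑ j, ((Bv j : ℝ) / F.N) * V j) + 2 * ∑ j, V j) + Real.log 3 ≤ 0) ∧
  (∀ (x₁ : ℤ) (a : ℕ), |x₁| ≤ (N' : ℤ) → a < T' →
    γb * N' + cU + cP + Real.log (DΔC (S.YC c e L) T') + Real.log (WC H ex L₀ T' ((12 * E + 6) * m)) +
      (w + (L S.j₀ : ℝ) * δ₀) * ((12 * E + 6) * m) - ((2 * m) * t : ℕ) * Real.log E +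
      (23 / 20 * a * H + 2 * |(x₁ : ℝ)| * (∑ j, ((Bv j : ℝ) / F.N) * V j) + 2 * ∑ j, V j) + Real.log 3 ≤ 0) ∧
  (∀ (x₁ : ℤ) (a : ℕ), |x₁| ≤ (N' : ℤ) → a < T' →
    cU + cP + Real.log (DΔC (S.YC c e L) T') + Real.log (WC H ex L₀ T (6 * m)) + (γb + w) * N' + cb' +
      (23 / 20 * a * H + 2 * |(x₁ : ℝ)| * (∑ j, ((Bv j : ℝ) / F.N) * V j) + 2 * ∑ j, V j) + Real.log 3 < 0)

/-- **The Kummer half-step's letter package** (from level `lev`, nodes `N = N lev n`, to the odd nodes `|s| ≤ 2N₁ − 1` of level `lev+1`;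
`R = Δ ∘ 2^{ex+1}·`, `R′ = Δ ∘ 2^{ex}·`): `1 ≤ t`, `T′ + t ≤ T`, `2N₁ ≤ 6N + 5`, `1 ≤ E`, `L_{j₀}·δ₀·(3N+2) ≤ 1`, `1 ≤ C`,
`2L_{j₀}δ₀N ≤ e^{cb}`, `2L_{j₀}δ₀(3N+2) ≤ e^{cbh}`, and the lines (J)/(F)/(C) with the threshold exponent
`Θ(s, a) = 2ⁿ·(log 4 + cD(s, a) + (log 2 + cU + cP + log DΔC + log MtV) + 2cH)` — verbatim the hypotheses of `archHalfStepHypD_of_logLinesV`.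
[cite: Nesterenko2003, §4.3 (4.36)–(4.51), p. 90–95; shape only] -/
def HalfStepLinesV (F : S.SatData) (H ex L₀ : ℕ) (L : Fin S.n → ℕ) (w γb : ℝ) (c : ℤ) (e : Fin S.n → ℤ) (δ₀ : ℝ)
    (Bv : Fin S.n → ℕ) (N N₁ T T' t : ℕ) (A : Fin S.n → ℝ) (E C : ℝ) (V : Fin S.n → ℝ) (cU cP cb cbh cH : ℝ) : Prop :=
  1 ≤ t ∧ T' + t ≤ T ∧ 2 * N₁ ≤ 6 * N + 5 ∧ 1 ≤ E ∧ (L S.j₀ : ℝ) * δ₀ * (3 * N + 2) ≤ 1 ∧ 1 ≤ C ∧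
  2 * ((L S.j₀ : ℝ) * δ₀ * N) ≤ Real.exp cb ∧ 2 * ((L S.j₀ : ℝ) * δ₀ * (3 * N + 2)) ≤ Real.exp cbh ∧
  (∀ (s : ℤ) (a : ℕ), Odd s → |s| ≤ 2 * (N₁ : ℤ) - 1 → a < T' →
    γb * (3 * N + 2) + Real.log (2 * ((2 * N + 1 : ℕ) : ℝ) ^ (t + 1) * t * (20 * Real.exp 1) ^ ((2 * N + 1) * t)) +
      t * Real.log (2 * C) + γb * (N + 1) + a * Real.log 2 + (∑ k, A k * S.GammaC L k) / C + cU + cP +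
      Real.log (DΔC (S.YC c e L) T') + Real.log (WC H (ex + 1) L₀ T N) + (γb + w) * N + cb +
      (2 : ℝ) ^ S.n * (Real.log 4 + (23 / 20 * a * H + (|(s : ℝ)| * ∑ j, ((Bv j : ℝ) / F.N) * V j +
        ∑ j, ((F.colU j : ℝ) / F.N) * V j + 2 * ∑ j, V j)) +
        (Real.log 2 + cU + cP + Real.log (DΔC (S.YC c e L) T') + Real.log (S.MtV A H ex L₀ T' N₁ (γb + w))) + 2 * cH) +
      Real.log 3 ≤ 0) ∧
  (∀ (s : ℤ) (a : ℕ), Odd s → |s| ≤ 2 * (N₁ : ℤ) - 1 → a < T' →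
    γb * (3 * N + 2) + cU + cP + Real.log (DΔC (S.YC c e L) T') + Real.log (WC H (ex + 1) L₀ T' ((3 * E + 1) * (2 * N + 1) + N)) +
      (w + (L S.j₀ : ℝ) * δ₀) * ((3 * E + 1) * (2 * N + 1) + N) - ((2 * N + 1) * t : ℕ) * Real.log E +
      (2 : ℝ) ^ S.n * (Real.log 4 + (23 / 20 * a * H + (|(s : ℝ)| * ∑ j, ((Bv j : ℝ) / F.N) * V j +
        ∑ j, ((F.colU j : ℝ) / F.N) * V j + 2 * ∑ j, V j)) +
        (Real.log 2 + cU + cP + Real.log (DΔC (S.YC c e L) T') + Real.log (S.MtV A H ex L₀ T' N₁ (γb + w))) + 2 * cH) +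
      Real.log 3 ≤ 0) ∧
  (∀ (s : ℤ) (a : ℕ), Odd s → |s| ≤ 2 * (N₁ : ℤ) - 1 → a < T' →
    cU + cP + Real.log (DΔC (S.YC c e L) T') + Real.log (WC H (ex + 1) L₀ T' N₁) + (γb + w) * (3 * N + 2) + cbh +
      (2 : ℝ) ^ S.n * (Real.log 4 + (23 / 20 * a * H + (|(s : ℝ)| * ∑ j, ((Bv j : ℝ) / F.N) * V j +
        ∑ j, ((F.colU j : ℝ) / F.N) * V j + 2 * ∑ j, V j)) +
        (Real.log 2 + cU + cP + Real.log (DΔC (S.YC c e L) T') + Real.log (S.MtV A H ex L₀ T' N₁ (γb + w))) + 2 * cH) +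
      Real.log 3 < 0)

/-! ### All lines of the schedule -/

/-- **The letter-lines package of the one-stage frame at `S(θ)`** (virtual instance; explicit arguments = those of `ArchPacksHoldV`):
letters `L₀, t, A, V, E, C, cb, cbo, cbh, cU, cP, cH` exist with the global side conditions `1 ≤ H`, `deg ≤ L₀` on `U`, `1 ≤ #U`,
`1 ≤ P`, `0 ≤ δ₀`, `0 ≤ wl lev`, `0 ≤ γb lev`, `cl (lev+1) ≠ 0`, `|log θₖ| ≤ Aₖ`, `h(α°ⱼ) ≤ Vⱼ`, `#U ≤ e^{cU}`, `P ≤ e^{cP}`,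
`log ∏H(θⱼ) ≤ cH`, and the four step families level-wise as in `ArchPacksHoldV`: `KStepLinesV` at `(0, ν)` (`ν < n`), and for `lev < Ŝ`:
`HalfStepLinesV` at `(lev, n) → (lev+1, 0)` (`ex := Ŝ − (lev+1)`), `OddStepLinesV` at `(lev+1, 0)` (`m := Nh (lev+1)`), `KStepLinesV` at
`(lev+1, ν)` (`1 ≤ ν < n`); step `(lev, ν)` reads `t lev ν`, `E lev ν`, `C lev ν`, box ceilings `cb lev ν`/`cb lev (ν+1)` (odd box
`cbo (lev+1)`, half box `cbh lev`), virtual box `Bv lev`.  This is the content of `stub_recLinesArch` at the START's letters (seat p1).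
[cite: Nesterenko2003, §4 Prop. 4.1, §4.2–4.3, p. 80–95; shape only] -/
def ArchLinesHoldV (F : S.SatData) (H Sh : ℕ) (s : Fin S.n → ℕ) (U : Finset (ℕ × (Fin S.n → ℤ))) (P : ℤ) (δ₀ : ℝ)
    (wl γb : ℕ → ℝ) (cl : ℕ → ℤ) (el : ℕ → Fin S.n → ℤ) (Bv : ℕ → Fin S.n → ℕ) (N T : ℕ → ℕ → ℕ) (Nh : ℕ → ℕ) : Prop :=
  ∃ (L₀ : ℕ) (t : ℕ → ℕ → ℕ) (A V : Fin S.n → ℝ) (E C cb : ℕ → ℕ → ℝ) (cbo cbh : ℕ → ℝ) (cU cP cH : ℝ),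
    1 ≤ H ∧ (∀ i ∈ U, i.1 ≤ L₀) ∧ 1 ≤ U.card ∧ 1 ≤ P ∧ 0 ≤ δ₀ ∧ (∀ lev, 0 ≤ wl lev) ∧ (∀ lev, 0 ≤ γb lev) ∧
    (∀ lev, cl (lev + 1) ≠ 0) ∧ (∀ k, |S.lg k| ≤ A k) ∧ (∀ j, Height.logHeight₁ (F.αo j) ≤ V j) ∧
    (U.card : ℝ) ≤ Real.exp cU ∧ (P : ℝ) ≤ Real.exp cP ∧ Real.log (heightProd S.α) ≤ cH ∧
    (∀ ν, ν < S.n → S.KStepLinesV F H (Sh - 0) L₀ (S.Lb s 0) (wl 0) (γb 0) (cl 0) (el 0) δ₀ (Bv 0) (N 0 ν) (N 0 (ν + 1))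
      (T 0 ν) (T 0 (ν + 1)) (t 0 ν) A (E 0 ν) (C 0 ν) V cU cP (cb 0 ν) (cb 0 (ν + 1))) ∧
    (∀ lev < Sh, S.HalfStepLinesV F H (Sh - (lev + 1)) L₀ (S.Lb s lev) (wl lev) (γb lev) (cl lev) (el lev) δ₀ (Bv lev)
      (N lev S.n) (Nh (lev + 1)) (T lev S.n) (T (lev + 1) 0) (t lev S.n) A (E lev S.n) (C lev S.n) V cU cP (cb lev S.n)
      (cbh lev) cH) ∧
    (∀ lev < Sh, S.OddStepLinesV F H (Sh - (lev + 1)) L₀ (S.Lb s (lev + 1)) (wl (lev + 1)) (γb (lev + 1)) (cl (lev + 1))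
      (el (lev + 1)) δ₀ (Bv (lev + 1)) (Nh (lev + 1)) (N (lev + 1) 1) (T (lev + 1) 0) (T (lev + 1) 1) (t (lev + 1) 0) A
      (E (lev + 1) 0) (C (lev + 1) 0) V cU cP (cbo (lev + 1)) (cb (lev + 1) 1)) ∧
    (∀ lev < Sh, ∀ ν, 1 ≤ ν → ν < S.n → S.KStepLinesV F H (Sh - (lev + 1)) L₀ (S.Lb s (lev + 1)) (wl (lev + 1))
      (γb (lev + 1)) (cl (lev + 1)) (el (lev + 1)) δ₀ (Bv (lev + 1)) (N (lev + 1) ν) (N (lev + 1) (ν + 1)) (T (lev + 1) ν)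
      (T (lev + 1) (ν + 1)) (t (lev + 1) ν) A (E (lev + 1) ν) (C (lev + 1) ν) V cU cP (cb (lev + 1) ν) (cb (lev + 1) (ν + 1)))

/-! ### Lines ⇒ packs -/

/-- **THE LINES BUY THE PACKS** (content of `stub_packsArch` of line `arch-g3-frame`): `ArchLinesHoldV ⇒ ArchPacksHoldV`, letter for
letter — level `0` and the levels `lev+1` by `archKStepHypD_of_logLinesV` / `archKStepOddHypD_of_logLinesV`, the half-steps by
`archHalfStepHypD_of_logLinesV` at `ex := Ŝ − (lev+1)` (`Ŝ − lev = ex + 1` as `lev < Ŝ`). [cite: Nesterenko2003, §4 Prop. 4.1, §4.2–4.3,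
p. 80–95] -/
theorem archPacksHoldV_of_linesHoldV (F : S.SatData) {H Sh : ℕ} {s : Fin S.n → ℕ} {U : Finset (ℕ × (Fin S.n → ℤ))} {P : ℤ}
    {δ₀ : ℝ} {wl γb : ℕ → ℝ} {cl : ℕ → ℤ} {el : ℕ → Fin S.n → ℤ} {Bv : ℕ → Fin S.n → ℕ} {N T : ℕ → ℕ → ℕ} {Nh : ℕ → ℕ}
    (h : S.ArchLinesHoldV F H Sh s U P δ₀ wl γb cl el Bv N T Nh) : S.ArchPacksHoldV F H Sh s U P δ₀ wl γb cl el Bv N T Nh := by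
  obtain ⟨L₀, t, A, V, E, C, cb, cbo, cbh, cU, cP, cH, hH, hU, hU1, hP1, hδ, hwl, hγb, hcl, hA, hV, hcU, hcP, hcH,
    hK0, hHf, hO, hK⟩ := h
  have hP0 : (0 : ℤ) ≤ P := zero_le_one.trans hP1
  refine ⟨?_, ?_, ?_, ?_⟩
  · -- level `0`: the symmetric k-steps `(0, ν) → (0, ν+1)`, `ν < n`
    intro ν hν
    obtain ⟨ht, hT, hN', hE, hsmall, hC, hcb, hcb', hJ, hFl, hCl⟩ := hK0 ν hν
    exact S.archKStepHypD_of_logLinesV F hH (Sh - 0) L₀ U hU (S.Lb s 0) hP0 (hwl 0) (γb 0) (cl 0) (el 0) hδ (Bv 0) ht hT hN'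
      hA hE hsmall hC hV hcU hcP hcb hcb' hJ hFl hCl
  · -- the half-steps `(lev, n) → (lev+1, 0)`, `lev < Ŝ`
    intro lev hlev
    obtain ⟨ht, hT, hN₁, hE, hsmall, hC, hcb, hcbh, hJ, hFl, hCl⟩ := hHf lev hlev
    have e : Sh - lev = Sh - (lev + 1) + 1 := by omega
    rw [e]
    exact S.archHalfStepHypD_of_logLinesV F hH (Sh - (lev + 1)) L₀ U hU hU1 (S.Lb s lev) hP1 (hwl lev) (hγb lev) (cl lev)
      (el lev) (hcl lev) (Bv lev) ht hT hN₁ hA hE hsmall hC hV hcU hcP hcb hcbh hcH hJ hFl hCl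
  · -- the odd-node first k-steps `(lev+1, 0) → (lev+1, 1)`, `lev < Ŝ`
    intro lev hlev
    obtain ⟨hm, ht, hT, hN', hE, hsmall, hC, hcb, hcb', hJ, hFl, hCl⟩ := hO lev hlev
    exact S.archKStepOddHypD_of_logLinesV F hH (Sh - (lev + 1)) L₀ U hU (S.Lb s (lev + 1)) hP0 (hwl (lev + 1)) (γb (lev + 1))
      (cl (lev + 1)) (el (lev + 1)) hδ (Bv (lev + 1)) hm ht hT hN' hA hE hsmall hC hV hcU hcP hcb hcb' hJ hFl hCl
  · -- the symmetric k-steps `(lev+1, ν) → (lev+1, ν+1)`, `1 ≤ ν < n`, `lev < Ŝ`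
    intro lev hlev ν hν1 hν
    obtain ⟨ht, hT, hN', hE, hsmall, hC, hcb, hcb', hJ, hFl, hCl⟩ := hK lev hlev ν hν1 hν
    exact S.archKStepHypD_of_logLinesV F hH (Sh - (lev + 1)) L₀ U hU (S.Lb s (lev + 1)) hP0 (hwl (lev + 1)) (γb (lev + 1))
      (cl (lev + 1)) (el (lev + 1)) hδ (Bv (lev + 1)) ht hT hN' hA hE hsmall hC hV hcU hcP hcb hcb' hJ hFl hCl

end ArchG3Setup

end Summit.ABC.StewartYu

end
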